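import Summits.FinalStateConjecture.FinalStateConjecture.Theorems.SwallowTheDatumSubdataDevelopmentsEmbedDoDAssembly
import Summits.FinalStateConjecture.FinalStateConjecture.Theorems.SwallowTheDatumSubdataDevelopmentsEmbedDoDTangent

/-!
# Route SwallowTheDatum · item `SubdataDevelopmentsEmbed` (stmt-FinalStateConjecture-10053) —
# the domain of dependence of the sub-datum (`hcauchy`) DISCHARGED

`hcauchy_holds`: for a vacuum Cauchy development `𝒟` of data on `X` and an open immersion /
embedding `Φ : N → X` of a connected `N`, the open piece `ι(Φ N)` of the Cauchy hypersurface
`ι(X)` is a Cauchy hypersurface of an open connected `V ⊆ M` containing it — verbatim the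
hypothesis `hcauchy` of `subdataDevelopmentsEmbed_of_hloc_hcauchy_hncb` (`…Skeleton2.lean`).
Proof: the soft assembly `exists_opens_isCauchyHypersurface_of_localDoD'` (`…DoDAssembly.lean`:
trichotomy and separation for `Σ`, the endpoint lemma, past/future extension of timelike curves,
connected components of the interior of the domain of dependence) fed with the local
domain-of-dependence lemma `localDoD_image` (`…DoDTangent.lean`, from the cone estimate, the
one-sided bounds and the tangency estimate of a spacelike data embedding).
Choquet-Bruhat–Geroch 1969, p. 331 ("D(S′) is a development of S′"); Hawking–Ellis 1973, §6.5–6.6.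

No definition, no named fact; pure composition.
-/

noncomputable section

open Function Set Filter Topology TopologicalSpace
open scoped Manifold ContDiff Topology

namespace Summit.FinalStateConjecture.FinalStateConjecture.Theorems

namespace SubdataDevelopmentsEmbed

open Literature.Geometry.Lorentzian

/-- **The domain of dependence of the sub-datum** (hypothesis `hcauchy` of
`subdataDevelopmentsEmbed_of_hloc_hcauchy_hncb`, discharged): for a vacuum Cauchy development `𝒟`
of data on `X` and an open embedding `Φ : N → X` of a connected manifold, there is an open
connected `V ⊆ M` containing `ι(Φ N)` in which `ι(Φ N)` is a Cauchy hypersurface.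
Choquet-Bruhat–Geroch 1969, p. 331 ("D(S′) is a development of S′"); Hawking–Ellis 1973,
Prop. 6.6.3 / 6.6.7; here from `exists_opens_isCauchyHypersurface_of_localDoD'` and
`localDoD_image`. -/
theorem hcauchy_holds (X : Type) [TopologicalSpace X] [ChartedSpace E3 X] [IsManifold (𝓡 3) ∞ X]
    [T2Space X] [SecondCountableTopology X] [ConnectedSpace X] (D : InitialDataSet (𝓡 3) X)
    (𝒟 : VacuumCauchyDevelopment D) (N : Type) [TopologicalSpace N] [ChartedSpace E3 N]
    [IsManifold (𝓡 3) ∞ N] [ConnectedSpace N] (Φ : N → X)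
    (hΦ : ContMDiff (𝓡 3) (𝓡 3) (∞ + 1) Φ) (hΦ' : ∀ u, Injective (mfderiv (𝓡 3) (𝓡 3) Φ u))
    (hΦo : IsOpenEmbedding Φ) :
    ∃ V : Opens 𝒟.carrier, IsConnected (V : Set 𝒟.carrier) ∧ (∀ u, 𝒟.embed (Φ u) ∈ V) ∧
      (𝒟.metric.restrict PseudoRiemannianMetric.contMDiff_restrict_holds V).IsCauchyHypersurface
        (𝒟.timeOrientation.restrict PseudoRiemannianMetric.contMDiff_restrict_holds
          𝒟.timeOrientation.contMDiff_restrict_holds V) (Subtype.val ⁻¹' range (𝒟.embed ∘ Φ)) := by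
  have _ := hΦ'
  haveI : LocallyConnectedSpace 𝒟.carrier :=
    ChartedSpace.locallyConnectedSpace (EuclideanSpace ℝ (Fin (3 + 1))) 𝒟.carrier
  have hn : (2 : ℕ∞ω) ≤ ∞ := WithTop.coe_le_coe.mpr le_top
  have hS : range (𝒟.embed ∘ Φ) = 𝒟.embed '' range Φ := Set.range_comp _ _
  have hSsub : range (𝒟.embed ∘ Φ) ⊆ range 𝒟.embed := by
    rw [hS]; exact image_subset_range _ _
  have hSc : IsConnected (range (𝒟.embed ∘ Φ)) :=
    isConnected_range (𝒟.isSmoothEmbedding.contMDiff.continuous.comp hΦ.continuous)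
  have hL := localDoD_image 𝒟.toCauchyDevelopment hΦo.isOpen_range
  rw [← hS] at hL
  obtain ⟨V, hVc, hSV, hV, -⟩ :=
    exists_opens_isCauchyHypersurface_of_localDoD' hn 𝒟.isCauchyHypersurface hSsub hSc hL
  exact ⟨V, hVc, fun u ↦ hSV ⟨u, rfl⟩, hV⟩

end SubdataDevelopmentsEmbed

end Summit.FinalStateConjecture.FinalStateConjecture.Theorems

end
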